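import Mathlib
import HarnessLib
import Literature.Combinatorics.Additive.KempermanStructureTheoremNecessity

/-!
# Grynkiewicz 2009, §6 Claim 5, case `l = 4`: «Finally, suppose we have type (IV)» — it cannot occur

[cite: Grynkiewicz2009, §6 Claim 5 (proof of Thm 4.1, p. 26, case l = 4, type (IV))] [tag: critical-pair]
[tag: inverse-theorem]

Topic `Literature/Combinatorics/Additive`.  Cell `mm-stpp` (D-0046), seat `mm-stpp-lit` (gen 24); the
port of D. J. Grynkiewicz, *A step beyond Kemperman's structure theorem*, Mathematika **55** (2009)
67–114 continued.  §6 Claim 5, case `l = 4`, last paragraph (print p. 26), as REUSABLE KST API in the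
style of `KempermanTypeTwoFourPairs.lean` («type (II) cannot occur»): a Kemperman decomposition (Kemperman's
form, quasi-period `L`) of a pair `(A, B)` carrying the (42)-data of the `l = 4` frame — `x, x + d ∈ A`,
`y, y + d ∈ B`, `d ≠ 0`, `2d = 0`, and every representation `u + v` (`u ∈ A`, `v ∈ B`) of `x + y` or of
`x + y + d` has `u ∈ {x, x + d}` and `v ∈ {y, y + d}` (display (42) = «`φ_K(γ₁)` is a unique expression
element in `φ_K(A) + φ_K(B)`», `K = {0, d}` here) — has a bottom pair NOT of type (IV).

SOURCE (print p. 26, p0026 L28–L47 of the held text): «Finally, suppose we have type (IV).  Hence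
`|φ_H(A₀′)|, |φ_H(B₀′)| ≥ 3`, and `φ_H(A₀′)` is aperiodic (all consequences for a type (IV) pair, as
remarked in Section 2).  If we do not have `a₁, a₂ ∈ A₀′` and `b₁, b₂ ∈ B₀′`, say instead `b₂ ∈ B₁′`, then
`|φ_H(A₀′)| ≥ 3` implies that every element of the form `φ_H(a) + φ_H(b₂) ∈ φ_H(A + B)`, where
`φ_H(a) ∈ φ_H(A)`, has at least three representations in `φ_H(A) + φ_H(B)`, which contradicts (42).
Therefore we may assume `a₁, a₂ ∈ A₀′` and `b₁, b₂ ∈ B₀′`.  Hence `K < L`.  Thus, since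
`φ_K(aᵢ) + φ_K(bᵢ)` is a unique expression element, it follows in view of Proposition 2.1 that (43)
`|φ_K(A₀′ + B₀′)| ≥ |φ_K(A₀′)| + |φ_K(B₀′)| − 1`.  In view of the description of type (IV), it follows
that `|φ_K(A₀′)| = l₁ + l_p` and `|φ_K(B₀′)| = l₂ + l_p`, where `l_p` is the number of partially filled
`K/H`-cosets in `φ_H(A₀′)` … and where `l₁ + l₂ + l_p = |L/K|`. … Hence, since … `φ_H(A₀′)` is aperiodic,
it follows in view of (43) that `l_p = 1`.  Let `φ_H(x) ∈ φ_H(A₀′)` and `φ_H(y) ∈ φ_H(B₀′)` be the elements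
that correspond to the unique partially filled `K/H`-coset in `φ_H(A₀′)` and `φ_H(B₀′)`, respectively.
Hence … `φ_K(x) + φ_K(y)` is a unique expression element in `φ_K(A₀′) + φ_K(B₀′)`.  However, since
`|K/H| = 2`, it follows that there is only one element from the coset `x + K/H` contained in `φ_H(A₀′)`,
and likewise for the coset `y + K/H` in `φ_H(B₀′)`, whence `φ_H(x) + φ_H(y)` is a unique expression
element, contradicting that there are no unique expression elements in a type (IV) pair.»

THIS FILE (the lemma is stated in the quotient `G/H` of the print, renamed `G`; `φ_H` dropped).
* `IsKempermanDecompI.mem_bottom_of_twoReps` — the first step: a `v ∈ B` with all representations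
  `u + w = x + v` having `u ∈ {x, x + d}` lies in the bottom `B₀` once `|A₀| ≥ 3` (else `v ∈ B₁` is
  `L`-periodic and three elements of `A₀` give three representations).
* `IsElementaryIV.false_of_twoReps` — the type (IV) computation, for `x, x + d ∈ A₀`, `y ∈ B₀` and the
  (42)-data inside the bottom pair.  DEVIATION (flagged): the print bounds the number `l_p` of `K`-holes
  of `A₀` by Proposition 2.1 (ii) (Kemperman–Scherk) and the count `|φ_K(A₀)| + |φ_K(B₀)| = |L/K| + l_p`;
  we bound it directly: with `s := x + y − g` (type (IV): `A₀ = g − (b + Q) ∖ B₀`, `A₀ + B₀ = (g + Q) ∖ {g}`)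
  the (42)-data say exactly that every `u ∈ A₀ ∖ {x, x + d}` has `u − s, u − s + d ∈ A₀`, so the
  `K`-periodic set `((A₀ ∖ {x, x + d}) + K) − s`, of size `|A₀ + K| − 2`, lies in `A₀`; hence
  `l_p = |A₀ + K| − |A₀| ≤ 2`, with `l_p = 2` making `A₀` `K`-periodic and `l_p = 0` likewise — so `l_p = 1`,
  and then (as printed) the element `g + d`, whose representations in `A₀ + B₀` are exactly the
  `u + (g + d − u)` with `u ∈ A₀`, `u + d ∉ A₀`, is a unique expression element of the type (IV) pair, a
  contradiction.  Same conclusion, shorter road (no passage to `G/K`).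
* `IsKempermanDecompI.not_isElementaryIV_of_twoReps` — «type (IV) cannot occur».

MAIN RESULTS (0 definitions, 0 named facts; everything PROVED): the three theorems above.

## References
* D. J. Grynkiewicz, *A step beyond Kemperman's structure theorem*, Mathematika 55 (2009) 67–114,
  doi:10.1112/S0025579300000966, §6 Claim 5 (p. 26), displays (42), (43); §2 (type (IV))
  [cite: Grynkiewicz2009, Thm 4.1 (proof, Claim 5)] — held `paper:doi-10-1112-s0025579300000966`,
  p0026 read 2026-08-29.
-/

namespace Literature.Combinatorics.Additive

open Finset
open scoped Pointwise

universe u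

variable {G : Type u} [AddCommGroup G] [DecidableEq G]

/-- Three distinct elements cannot all lie in a two-element set. [folklore] -/
private theorem false_of_three_mem_pair {α : Type*} {p q r s t : α} (hpq : p ≠ q) (hpr : p ≠ r)
    (hqr : q ≠ r)
    (hp : p = s ∨ p = t) (hq : q = s ∨ q = t) (hr : r = s ∨ r = t) : False := by
  rcases hp with rfl | rfl <;> rcases hq with rfl | rfl <;> rcases hr with h | h
  all_goals first | exact hpq rfl | exact hpr h.symm | exact hqr h.symm

namespace IsKempermanDecompI

variable {L : AddSubgroup G} {A B A₁ A₀ B₁ B₀ : Finset G}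

/-- **First step** («If we do not have `a₁, a₂ ∈ A₀′` and `b₁, b₂ ∈ B₀′`, say instead `b₂ ∈ B₁′`, then
`|φ_H(A₀′)| ≥ 3` implies that every element of the form `φ_H(a) + φ_H(b₂)` … has at least three
representations … which contradicts (42)»).  For a Kemperman decomposition with `|A₀| ≥ 3`: if `x ∈ A`,
`v ∈ B`, and every representation `u + w = x + v` (`u ∈ A`, `w ∈ B`) has `u ∈ {x, x + d}`, then
`v ∈ B₀` — were `v` in the `L`-periodic part `B₁`, three elements `a₁, a₂, a₃ ∈ A₀` (one `L`-coset) would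
give the three representations `(x + (aᵢ − c)) + (v − (aᵢ − c))` (`c = a₁` if `x ∈ A₁`, `c = x` if
`x ∈ A₀`). [cite: Grynkiewicz2009, §6 Claim 5 (p. 26, type (IV), first step)] -/
theorem mem_bottom_of_twoReps (h : IsKempermanDecompI L A B A₁ A₀ B₁ B₀) (h3 : 3 ≤ #A₀) {x v d : G}
    (hx : x ∈ A) (hv : v ∈ B) (hrep : ∀ u ∈ A, ∀ w ∈ B, u + w = x + v → u = x ∨ u = x + d) :
    v ∈ B₀ := by
  have hvB : v ∈ B₁ ∪ B₀ := by rw [h.decomp_right.union_eq]; exact hv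
  rcases mem_union.1 hvB with hv₁ | hv₀
  · exfalso
    obtain ⟨a₁, ha₁, a₂, ha₂, a₃, ha₃, h12, h13, h23⟩ := two_lt_card.1 (by omega : 2 < #A₀)
    have hxA : x ∈ A₁ ∪ A₀ := by rw [h.decomp_left.union_eq]; exact hx
    -- representations `(x + l) + (v - l)` for `l ∈ L` with `x + l ∈ A`
    have rep : ∀ {l : G}, l ∈ L → l + x ∈ A → l = 0 ∨ l = d := by
      intro l hl hlx
      have hw : -l + v ∈ B := h.decomp_right.left_subset (h.decomp_right.periodic.add_mem (L.neg_mem hl) hv₁)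
      rcases hrep _ hlx _ hw (by abel) with e | e
      · exact Or.inl (by rw [← add_eq_right (b := x)]; exact e)
      · exact Or.inr (add_right_cancel (e.trans (add_comm x d)))
    rcases mem_union.1 hxA with hx₁ | hx₀
    · -- `c = a₁`
      have r : ∀ {a : G}, a ∈ A₀ → a - a₁ = 0 ∨ a - a₁ = d := fun {a} ha =>
        rep (h.decomp_left.sub_mem a ha a₁ ha₁)
          (h.decomp_left.left_subset (h.decomp_left.periodic.add_mem (h.decomp_left.sub_mem a ha a₁ ha₁) hx₁))
      refine false_of_three_mem_pair (s := (0 : G)) (t := d) ?_ ?_ ?_ (r ha₁) (r ha₂) (r ha₃)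
      · exact fun e => h12 (by rw [sub_self] at e; exact (sub_eq_zero.1 e.symm).symm)
      · exact fun e => h13 (by rw [sub_self] at e; exact (sub_eq_zero.1 e.symm).symm)
      · exact fun e => h23 (sub_left_injective e)
    · -- `c = x`
      have r : ∀ {a : G}, a ∈ A₀ → a - x = 0 ∨ a - x = d := fun {a} ha =>
        rep (h.decomp_left.sub_mem a ha x hx₀) (by rw [sub_add_cancel]; exact h.decomp_left.right_subset ha)
      refine false_of_three_mem_pair (s := (0 : G)) (t := d) ?_ ?_ ?_ (r ha₁) (r ha₂) (r ha₃)
      · exact fun e => h12 (sub_left_injective e)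
      · exact fun e => h13 (sub_left_injective e)
      · exact fun e => h23 (sub_left_injective e)
  · exact hv₀

end IsKempermanDecompI

/-- **The type (IV) computation** (print p. 26, «Finally, suppose we have type (IV) … contradicting that
there are no unique expression elements in a type (IV) pair»; road as in the module docstring).  A type
(IV) pair `(A₀, B₀)` cannot contain `x, x + d ∈ A₀`, `y ∈ B₀` (`d ≠ 0`, `2d = 0`) such that every
representation `u + v` (`u ∈ A₀`, `v ∈ B₀`) of `x + y` or of `x + y + d` has `u ∈ {x, x + d}`.
With the type (IV) data `A₀ ⊆ a + Q`, `B₀ ⊆ b + Q`, `A₀ = g − (b + Q) ∖ B₀` and `s = x + y − g`: every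
`u ∈ A₀ ∖ {x, x + d}` has `u − s ∈ A₀` and `u − s + d ∈ A₀` (else `x + y`, resp. `x + y + d`, gets the
representation `u + (x + y − u)`); so `((A₀ ∖ {x, x + d}) + {0, d}) − s ⊆ A₀`, a set of size
`|A₀ + {0, d}| − 2`; `A₀` aperiodic forces `|A₀ + {0, d}| = |A₀| + 1` («`l_p = 1`»), i.e. exactly one
`p ∈ A₀` with `p + d ∉ A₀`; and then `g + d = p + (g + d − p)` is a unique expression element of
`A₀ + B₀` (its representations are the `u + (g + d − u)` with `u ∈ A₀`, `u + d ∉ A₀`).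
[cite: Grynkiewicz2009, §6 Claim 5 (p. 26, type (IV)), (43)] -/
theorem IsElementaryIV.false_of_twoReps {A₀ B₀ : Finset G} (hIV : IsElementaryIV A₀ B₀) {x y d : G}
    (hx : x ∈ A₀) (hxd : x + d ∈ A₀) (hy : y ∈ B₀) (hd : d ≠ 0) (h2d : d + d = 0)
    (hK : ∀ u ∈ A₀, ∀ v ∈ B₀, (u + v = x + y ∨ u + v = x + y + d) → u = x ∨ u = x + d) : False := by
  obtain ⟨Q, a, b, g, ha, -, hAQ, hBQ, hno, hAap, -, hAeq⟩ := hIV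
  have hneg : -d = d := by rw [neg_eq_iff_add_eq_zero, h2d]
  have hdQ : d ∈ Q := by
    have := Q.sub_mem (hAQ _ hxd) (hAQ _ hx)
    rwa [show x + d - a - (x - a) = d by abel] at this
  have hgQ : g - a - b ∈ Q := ((hAeq a).1 ha).1
  set s := x + y - g with hs
  -- (a) the (42)-data: `u - s + e ∈ A₀` for `u ∈ A₀ \ {x, x + d}`, `e ∈ {0, d}`
  have memA : ∀ u ∈ A₀, u ≠ x → u ≠ x + d → ∀ e : G, e = 0 ∨ e = d → u - s + e ∈ A₀ := by
    intro u hu hux huxd e he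
    rw [hAeq]
    constructor
    · have e1 : g - (u - s + e) - b = (x - a) + (y - b) - (u - a) - e := by rw [hs]; abel
      rw [e1]
      refine Q.sub_mem (Q.sub_mem (Q.add_mem (hAQ _ hx) (hBQ _ hy)) (hAQ _ hu)) ?_
      rcases he with rfl | rfl
      exacts [Q.zero_mem, hdQ]
    · intro hv
      have hsum : u + (g - (u - s + e)) = x + y - e := by rw [hs]; abel
      have hsum' : u + (g - (u - s + e)) = x + y ∨ u + (g - (u - s + e)) = x + y + d := by
        rcases he with rfl | rfl
        · left; rw [hsum, sub_zero]
        · right; rw [hsum, sub_eq_add_neg, hneg]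
      rcases hK u hu _ hv hsum' with h1 | h1
      exacts [hux h1, huxd h1]
  -- (b) the translate of `(A₀ \ {x, x + d}) + {0, d}` by `-s` lies in `A₀`
  set Kf : Finset G := {0, d} with hKf
  have hmemKf : ∀ e, e ∈ Kf ↔ e = 0 ∨ e = d := fun e => by rw [hKf, mem_insert, mem_singleton]
  set A' : Finset G := A₀ \ {x, x + d} with hA'
  have hsub : (-s) +ᵥ (A' + Kf) ⊆ A₀ := by
    intro z hz
    obtain ⟨w, hw, rfl⟩ := mem_vadd_finset.1 hz
    obtain ⟨u, hu, e, he, rfl⟩ := mem_add.1 hw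
    rw [hA', mem_sdiff, mem_insert, mem_singleton, not_or] at hu
    rw [vadd_eq_add, show -s + (u + e) = u - s + e by abel]
    exact memA u hu.1 hu.2.1 hu.2.2 e ((hmemKf e).1 he)
  -- `A₀ + Kf = (A' + Kf) ∪ {x, x + d}`, disjointly
  have hxxd : x ≠ x + d := fun e => hd ((add_eq_left.1 e.symm))
  have hpairK : ({x, x + d} : Finset G) + Kf = {x, x + d} := by
    ext z
    simp only [mem_add, mem_insert, mem_singleton, hmemKf]
    constructor
    · rintro ⟨u, hu, e, he, rfl⟩
      rcases hu with rfl | rfl <;> rcases he with rfl | rfl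
      · exact Or.inl (add_zero _)
      · exact Or.inr rfl
      · exact Or.inr (add_zero _)
      · exact Or.inl (by rw [add_assoc, h2d, add_zero])
    · rintro (rfl | rfl)
      · exact ⟨_, Or.inl rfl, 0, Or.inl rfl, add_zero _⟩
      · exact ⟨_, Or.inr rfl, 0, Or.inl rfl, add_zero _⟩
  have hA₀eq : A₀ = A' ∪ {x, x + d} := by
    rw [hA', sdiff_union_of_subset]
    intro z hz
    rw [mem_insert, mem_singleton] at hz
    rcases hz with rfl | rfl
    exacts [hx, hxd]
  have hdisj : Disjoint (A' + Kf) {x, x + d} := by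
    rw [disjoint_left]
    rintro z hz hzx
    obtain ⟨u, hu, e, he, rfl⟩ := mem_add.1 hz
    rw [hA', mem_sdiff, mem_insert, mem_singleton, not_or] at hu
    rw [mem_insert, mem_singleton] at hzx
    rcases (hmemKf e).1 he with rfl | rfl
    · rw [add_zero] at hzx
      rcases hzx with h1 | h1
      exacts [hu.2.1 h1, hu.2.2 h1]
    · rcases hzx with h1 | h1
      · exact hu.2.2 (by rw [← h1, add_assoc, h2d, add_zero])
      · exact hu.2.1 (add_right_cancel h1)
  have hcard : #(A₀ + Kf) = #(A' + Kf) + 2 := by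
    rw [hA₀eq, union_add, hpairK, card_union_of_disjoint hdisj, card_pair hxxd]
  -- hence `|A₀ + Kf| ≤ |A₀| + 2`
  have hle : #(A' + Kf) ≤ #A₀ := by
    have := card_le_card hsub; rwa [card_vadd_finset] at this
  -- `Kf`-periodicity tools
  have hdKf : d +ᵥ Kf = Kf := by
    ext z
    simp only [mem_vadd_finset, hmemKf, vadd_eq_add]
    constructor
    · rintro ⟨e, he, rfl⟩
      rcases he with rfl | rfl
      · exact Or.inr (add_zero _)
      · exact Or.inl h2d
    · rintro (rfl | rfl)
      · exact ⟨d, Or.inr rfl, h2d⟩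
      · exact ⟨0, Or.inl rfl, add_zero _⟩
  have hKne : AddSubgroup.zmultiples d ≠ ⊥ := by
    rw [Ne, AddSubgroup.zmultiples_eq_bot]; exact hd
  have notper : ∀ {P : Finset G}, d +ᵥ P = P → P = A₀ → False := by
    intro P hP hPA
    rw [hPA] at hP
    exact hAap ⟨_, hKne, isPeriodicWith_zmultiples_of_vadd_eq hP⟩
  -- `|A₀ + Kf| ≠ |A₀| + 2`: else `A₀` is a translate of the `Kf`-periodic set `A' + Kf`
  have hne2 : #(A' + Kf) ≠ #A₀ := by
    intro he
    have heq : (-s) +ᵥ (A' + Kf) = A₀ :=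
      eq_of_subset_of_card_le hsub (by rw [card_vadd_finset, he])
    have hdX : d +ᵥ (A' + Kf) = A' + Kf := by rw [add_comm A' Kf, ← vadd_add_assoc, hdKf]
    refine notper ?_ heq
    rw [vadd_vadd, add_comm, ← vadd_vadd, hdX]
  -- `|A₀ + Kf| ≠ |A₀|`: else `A₀` is `Kf`-periodic
  have hdA₀ : d +ᵥ A₀ ⊆ A₀ + Kf := fun z hz => by
    obtain ⟨u, hu, rfl⟩ := mem_vadd_finset.1 hz
    exact mem_add.2 ⟨u, hu, d, (hmemKf d).2 (Or.inr rfl), by rw [vadd_eq_add, add_comm]⟩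
  have h0Kf : (0 : G) ∈ Kf := (hmemKf 0).2 (Or.inl rfl)
  have hne0 : #(A₀ + Kf) ≠ #A₀ := by
    intro he
    have heq : A₀ + Kf = A₀ := (eq_of_subset_of_card_le (subset_add_left A₀ h0Kf) (le_of_eq he)).symm
    exact notper (eq_of_subset_of_card_le (hdA₀.trans heq.subset) (by rw [card_vadd_finset])) rfl
  -- so `A₀` has exactly one `Kf`-hole («l_p = 1»)
  have hone : #(A₀ + Kf) = #A₀ + 1 := by
    have := card_le_card (subset_add_left A₀ h0Kf)
    omega
  -- (c) the unique `p ∈ A₀` with `p + d ∉ A₀`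
  have hunion : A₀ + Kf = (d +ᵥ A₀) ∪ A₀ := by
    ext z
    simp only [mem_add, mem_union, mem_vadd_finset, hmemKf, vadd_eq_add]
    constructor
    · rintro ⟨u, hu, e, he, rfl⟩
      rcases he with rfl | rfl
      · exact Or.inr (by rw [add_zero]; exact hu)
      · exact Or.inl ⟨u, hu, add_comm _ _⟩
    · rintro (⟨u, hu, rfl⟩ | hz)
      · exact ⟨u, hu, d, Or.inr rfl, add_comm _ _⟩
      · exact ⟨z, hz, 0, Or.inl rfl, add_zero _⟩
  have hsd : #((d +ᵥ A₀) \ A₀) = 1 := by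
    have := card_sdiff_add_card (s := d +ᵥ A₀) (t := A₀)
    rw [← hunion, hone] at this
    omega
  obtain ⟨w, hw⟩ := card_eq_one.1 hsd
  have hwmem : w ∈ (d +ᵥ A₀) \ A₀ := by rw [hw]; exact mem_singleton_self _
  rw [mem_sdiff] at hwmem
  obtain ⟨p, hp, hpw⟩ := mem_vadd_finset.1 hwmem.1
  rw [vadd_eq_add] at hpw
  have hpd : p + d ∉ A₀ := by rw [add_comm, hpw]; exact hwmem.2
  have huniq : ∀ u ∈ A₀, u + d ∉ A₀ → u = p := by
    intro u hu hud
    have : u + d ∈ (d +ᵥ A₀) \ A₀ :=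
      mem_sdiff.2 ⟨mem_vadd_finset.2 ⟨u, hu, by rw [vadd_eq_add, add_comm]⟩, hud⟩
    rw [hw, mem_singleton, ← hpw] at this
    exact add_left_cancel (a := d) (by rw [add_comm d u, this])
  -- the equivalence `g + d - u ∈ B₀ ↔ u + d ∉ A₀` on `a + Q`
  have hE : ∀ u : G, u - a ∈ Q → (g + d - u ∈ B₀ ↔ u + d ∉ A₀) := by
    intro u huQ
    have e1 : g - (u + d) = g + d - u := by
      rw [show g - (u + d) = g - u + -d by abel, hneg]; abel
    have h1 := hAeq (u + d)
    rw [e1] at h1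
    have hQ' : g + d - u - b ∈ Q := by
      rw [show g + d - u - b = (g - a - b) + d - (u - a) by abel]
      exact Q.sub_mem (Q.add_mem hgQ hdQ) huQ
    constructor
    · intro hB hud; exact (h1.1 hud).2 hB
    · intro hud
      by_contra hB
      exact hud (h1.2 ⟨hQ', hB⟩)
  -- `g + d` is a unique expression element of `A₀ + B₀`
  refine hno (g + d) (addConvolution_eq_one_iff.2 ⟨g + d - p, (hE p (hAQ p hp)).2 hpd, ?_, ?_⟩)
  · rw [sub_sub_cancel]; exact hp
  · intro b' hb' hgb'
    have hu := huniq _ hgb' ((hE _ (hAQ _ hgb')).1 (by rw [sub_sub_cancel]; exact hb'))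
    rw [← hu, sub_sub_cancel]

/-- **«Type (IV) cannot occur» (Claim 5, case `l = 4`).**  For a Kemperman decomposition (Kemperman's
form) of `(A, B)` with elements `x, x + d ∈ A`, `y ∈ B` (`d ≠ 0`, `2d = 0`; in the frame also
`y + d ∈ B`, not needed) such that every representation `u + v` (`u ∈ A`, `v ∈ B`) of `x + y` or of
`x + y + d` has `u ∈ {x, x + d}` and `v ∈ {y, y + d}` (display (42), i.e. «`φ_K(γ₁)` is a unique
expression element in `φ_K(A) + φ_K(B)`»): the bottom pair is not of type (IV).  By `mem_bottom_of_twoReps` (type (IV) pairs have `|A₀|, |B₀| ≥ 3`)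
all four elements lie in the bottom pair, and `IsElementaryIV.false_of_twoReps` ends it.
[cite: Grynkiewicz2009, §6 Claim 5 (p. 26, «Finally, suppose we have type (IV) …»)] -/
theorem IsKempermanDecompI.not_isElementaryIV_of_twoReps {L : AddSubgroup G}
    {A B A₁ A₀ B₁ B₀ : Finset G} (h : IsKempermanDecompI L A B A₁ A₀ B₁ B₀) {x y d : G}
    (hx : x ∈ A) (hxd : x + d ∈ A) (hy : y ∈ B) (hd : d ≠ 0) (h2d : d + d = 0)
    (hK : ∀ u ∈ A, ∀ v ∈ B, (u + v = x + y ∨ u + v = x + y + d) →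
      (u = x ∨ u = x + d) ∧ (v = y ∨ v = y + d)) :
    ¬ IsElementaryIV A₀ B₀ := by
  intro hIV
  obtain ⟨hA3, hB3⟩ := hIV.three_le_card
  have hy₀ : y ∈ B₀ :=
    h.mem_bottom_of_twoReps hA3 hx hy fun u hu w hw e => (hK u hu w hw (Or.inl e)).1
  have hx₀ : x ∈ A₀ :=
    h.symm.mem_bottom_of_twoReps hB3 hy hx fun v hv u hu e =>
      (hK u hu v hv (Or.inl (by rw [add_comm, e, add_comm]))).2
  have hxd₀ : x + d ∈ A₀ :=
    h.symm.mem_bottom_of_twoReps hB3 hy hxd fun v hv u hu e =>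
      (hK u hu v hv (Or.inr (by rw [add_comm, e]; abel))).2
  have hsubA : A₀ ⊆ A := h.decomp_left.right_subset
  have hsubB : B₀ ⊆ B := h.decomp_right.right_subset
  exact hIV.false_of_twoReps hx₀ hxd₀ hy₀ hd h2d fun u hu v hv huv =>
    (hK u (hsubA hu) v (hsubB hv) huv).1

end Literature.Combinatorics.Additive
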